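import Literature.Computability.Complexity.PerfectMatchingNegativeError
import HarnessLib

/-!
# Razborov's theorem for the logical permanent: the dichotomy (Jukna 2012, proof of Thm. 9.38)

The approximation method (`ApproxScheme.exists_approx_circuit`, Jukna's Thm. 9.30) run in
Razborov's lattice `𝔐_m` for the perfect matching function (`PerfectMatching.scheme`, Jukna
§9.11) with the positive error of Lemma 9.34 (`sum_lostInf_le`) and the negative error of
Lemma 9.37 (`sum_gainedSup_le`, `PerfectMatchingNegativeError.lean`), followed by the case distinction `M = ∅` / `M ≠ ∅` of the
proof of Theorem 9.38 — with the parameters `r, s, q` still free. PROVED: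

* `PerfectMatching.razborov_dichotomy` — for a circuit of size `t` over `{∧₂, ∨₂}` computing a
  function `f` on the edges of `K_{m,m}` that accepts every perfect matching, and `r ≥ 2`,
  `s ≥ 1`, `(s q)² ≤ r`: either (Case 1, the output approximator is `∅`)
  `m! ≤ t · ((r-1)^s)^2 · (m-s-1)!`, or (Case 2) some matching `E ∈ Per_s` has
  `#{h : f(E₋(h)) = 0} ≤ t · |Per_s| · ⌊(2ˢ-1)^q 4^m/(2ˢ)^q⌋ + #{h : E ⊄ E₋(h)}`, where
  `#{h : E ⊆ E₋(h)} = 4^m / 2^{|E|}` (`card_filter_subset_colorGraph_mul`).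

The choice `s ≍ log m`, `q ≍ m^{1/8}`, `r = s² q²` and the estimate `Prob[f_m(E₋) = 1] → 0`
(Lemma 9.33) that turn this into `m^{Ω(log m)}` are in
`Literature/Barriers/PneNP/MonotoneGapPerfectMatchingProofs.lean`.

## References

* S. Jukna, *Boolean Function Complexity: Advances and Frontiers*, Springer (2012), Thm. 9.30,
  §9.11, Thm. 9.38 (PDF pp. 289–296) [Jukna2012].
* A. A. Razborov, *Lower bounds on monotone complexity of the logical permanent*, Mat. Zametki
  37 (1985) 887–900 [Razborov1985b].
-/

namespace Literature.Computability.Complexity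

namespace PerfectMatching

open Finset Razborov

/-- **Razborov's dichotomy for the logical permanent** (Jukna 2012, proof of Thm. 9.38, Cases 1
and 2, before the choice of parameters). Let `r ≥ 2`, `s ≥ 1`, `(s q)² ≤ r`, and let a circuit
of size `t` over `{∧₂, ∨₂}` compute a function `f` on the `m²` edge variables of `K_{m,m}` that
accepts (the graph of) every perfect matching. Then either
`m! ≤ t · ((r-1)^s)^2 · (m-s-1)!` (every perfect matching is lost at some approximate AND), or
there is a matching `E ∈ Per_s` in the output approximator, so that every colouring `h` with
`f(E₋(h)) = 0` is wrongly accepted at some approximate OR or has `E ⊄ E₋(h)`: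
`#{h : f(E₋(h)) = 0} ≤ t · |Per_s| · ⌊(2ˢ-1)^q 4^m / (2ˢ)^q⌋ + #{h : E ⊄ E₋(h)}`.
[cite: Jukna2012, Thm. 9.38 (PDF pp. 295–296)] [cite: Razborov1985b] -/
theorem razborov_dichotomy {m r s q : ℕ} (hr : 2 ≤ r) (hs : 1 ≤ s) (hqr : (s * q) ^ 2 ≤ r)
    (C : Circuit (Edge m)) (hC : C.IsOver monotoneBasis) {f : (Edge m → Bool) → Bool}
    (hf : C.Computes f) (hpos : ∀ σ : Equiv.Perm (Fin m), f (permInput σ) = true) :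
    (m.factorial : ℝ) ≤ C.size * ((((r - 1) ^ s) ^ 2 * (m - (s + 1)).factorial : ℕ) : ℝ) ∨
    ∃ E ∈ Per m s,
      (#(univ.filter fun h : Vtx m → Bool => f (colorInput h) = false) : ℝ) ≤
        C.size * ((#(Per m s) * ((2 ^ s - 1) ^ q * 4 ^ m / (2 ^ s) ^ q) : ℕ) : ℝ) +
          #(univ.filter fun h : Vtx m → Bool => ¬ E ⊆ colorGraph h) := by
  classical
  have hδP : (0 : ℝ) ≤ ((((r - 1) ^ s) ^ 2 * (m - (s + 1)).factorial : ℕ) : ℝ) := Nat.cast_nonneg _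
  have hδN : (0 : ℝ) ≤ ((#(Per m s) * ((2 ^ s - 1) ^ q * 4 ^ m / (2 ^ s) ^ q) : ℕ) : ℝ) :=
    Nat.cast_nonneg _
  obtain ⟨a, BadP, BadN, hok, hcP, hcN, hposI, hnegI⟩ :=
    (scheme m r s hr hs).exists_approx_circuit (univ : Finset (Equiv.Perm (Fin m))) permInput
      (fun _ => (1 : ℝ)) (univ : Finset (Vtx m → Bool)) colorInput (fun _ => (1 : ℝ))
      (fun _ => zero_le_one) (fun _ => zero_le_one)
      ((((r - 1) ^ s) ^ 2 * (m - (s + 1)).factorial : ℕ) : ℝ)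
      ((#(Per m s) * ((2 ^ s - 1) ^ q * 4 ^ m / (2 ^ s) ^ q) : ℕ) : ℝ)
      (fun A B hA hB => by rw [lostSup_eq_empty hr hs _ _ hA hB, sum_empty]; exact hδP)
      (fun A B hA hB => sum_lostInf_le hr hs hA hB)
      (fun A B hA hB => sum_gainedSup_le hr hs hqr hA hB)
      (fun A B _ _ => by rw [gainedInf_eq_empty hr hs, sum_empty]; exact hδN)
      C hC hf
  obtain ⟨h1, h2⟩ := (scheme m r s hr hs).weight_le_of_approx (fun _ => zero_le_one)
    (fun _ => zero_le_one) hcP hcN hposI hnegI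
  simp only [sum_const, nsmul_eq_mul, mul_one] at h1 h2
  by_cases ha : a = ∅
  · -- Case 1: the output approximator is empty, every perfect matching is lost
    left
    subst ha
    have hP : (univ.filter fun σ : Equiv.Perm (Fin m) => f (permInput σ) = true) = univ :=
      filter_true_of_mem fun σ _ => hpos σ
    have hV : (univ.filter fun σ : Equiv.Perm (Fin m) =>
        (scheme m r s hr hs).val ∅ (permInput σ) = true) = ∅ := by
      refine filter_false_of_mem fun σ _ h => ?_
      rw [scheme_val_eq_true_iff] at h
      obtain ⟨E, hE, -⟩ := h
      exact notMem_empty E hE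
    rw [hP, hV, card_univ, Fintype.card_perm, Fintype.card_fin, card_empty, Nat.cast_zero,
      add_zero] at h1
    exact h1
  · -- Case 2: a matching `E` in the output approximator
    right
    have hok' : IsClosedIn r (Per m s) a := hok
    obtain ⟨E, hE⟩ := nonempty_iff_ne_empty.2 ha
    refine ⟨E, hok'.subset hE, h2.trans (add_le_add le_rfl (Nat.cast_le.2 (card_le_card fun h hh => ?_)))⟩
    obtain ⟨-, hval⟩ := mem_filter.1 hh
    refine mem_filter.2 ⟨mem_univ _, fun hsub => ?_⟩
    have : (scheme m r s hr hs).val a (colorInput h) = true := by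
      rw [scheme_val_eq_true_iff, edgesOf_colorInput]
      exact ⟨E, hE, hsub⟩
    rw [this] at hval
    exact Bool.noConfusion hval

end PerfectMatching

end Literature.Computability.Complexity
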